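import Summits.Ventures.HodgeRepro2.T5BergmanCoefficient
import Summits.Ventures.HodgeRepro2.DiscMeanValue

/-!
# The lowest `K`-type of the Bergman model has multiplicity one

In the weight-`k` Bergman model the rotation subgroup `K = {rot u}` acts by
`(π_k(rot u) f)(z) = u^{-k} f(ū² z)`.  A holomorphic function on the disc which is a weight vector of
weight `k` — `π_k(rot u) f = u^{-k} f` for all `u` — is therefore rotation-invariant,
`f(w z) = f(z)` for all `|w| = 1`, and a rotation-invariant holomorphic function is constant: by
the circle mean value (`DiscMeanValue.integral_angle`), `2π f(z) = ∫_{-π}^{π} f(|z| e^{iθ}) dθ = 2π f(0)`.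

So the weight-`k` vectors among the holomorphic functions are exactly the constants: the lowest
`K`-type of the model occurs with multiplicity one, and `1` is «the» lowest-weight vector up to a
scalar — the `f` of S4 l. 82.

Blind lane: Mathlib + the HodgeRepro2 prefix only (own files + p2's `DiscMeanValue`); no sorry;
axioms ⊆ {propext, Classical.choice, Quot.sound}.
-/

namespace Summit.Ventures.HodgeRepro2.T5BergmanLowestWeight

open MeasureTheory Metric Complex
open T5PoincareDensity T5SU11Unimodular T5SU11Fibration T5BergmanCoefficient
open scoped Real

/-! ### The action of the rotation subgroup on arbitrary functions -/

/-- The matrix of `(rot u)⁻¹` is `diag(ū, u)`. -/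
lemma mat_rot_inv (u : Circle) : mat (rot u)⁻¹ = su11 ((starRingEnd ℂ) (u : ℂ)) 0 := by
  rw [mat_inv]
  simp [su11]

/-- `(π_k(rot u) f)(z) = u^{-k} f(ū² z)`. -/
theorem act_rot (k : ℕ) (u : Circle) (f : ℂ → ℂ) (z : ℂ) :
    act k (rot u) f z = ((u : ℂ)⁻¹) ^ k * f (((u : ℂ)⁻¹) ^ 2 * z) := by
  unfold act
  rw [mat_rot_inv, denom_su11, mobius_su11]
  simp only [map_zero, zero_mul, zero_add, add_zero, Complex.conj_conj]
  rw [← Circle.coe_inv_eq_conj, Circle.coe_inv]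
  have hu : (u : ℂ) ≠ 0 := Circle.coe_ne_zero u
  rw [show (u : ℂ)⁻¹ * z / (u : ℂ) = (u : ℂ)⁻¹ ^ 2 * z by field_simp]

/-! ### Rotation-invariant holomorphic functions are constant -/

/-- Every `w ∈ Circle` is `(u⁻¹)²` for some `u ∈ Circle` (square roots exist on the circle). -/
lemma exists_inv_sq_eq (w : Circle) : ∃ u : Circle, u⁻¹ ^ 2 = w := by
  obtain ⟨t, rfl⟩ := Circle.exp_surjective w
  refine ⟨Circle.exp (-(t / 2)), ?_⟩
  rw [Circle.exp_neg, inv_inv, sq, ← Circle.exp_add]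
  congr 1
  ring

/-- **A rotation-invariant holomorphic function on the disc is constant**: if
`f (w z) = f z` for all `|w| = 1` and `z ∈ 𝔻`, then `f z = f 0` on `𝔻` (circle mean value). -/
theorem eq_const_of_rot_invariant (f : ℂ → ℂ) (hf : DifferentiableOn ℂ f (ball 0 1))
    (hinv : ∀ (w : Circle) (z : ℂ), z ∈ ball (0 : ℂ) 1 → f ((w : ℂ) * z) = f z) :
    ∀ z ∈ ball (0 : ℂ) 1, f z = f 0 := by
  intro z hz
  have hz1 : ‖z‖ < 1 := mem_ball_zero_iff.mp hz
  by_cases hz0 : z = 0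
  · rw [hz0]
  set r : ℝ := ‖z‖ with hr
  have hr0 : 0 < r := norm_pos_iff.mpr hz0
  set R : ℝ := (r + 1) / 2 with hR
  have hrR : r < R := by rw [hR]; linarith
  have hR1 : R < 1 := by rw [hR]; linarith
  have hfR : DiffContOnCl ℂ f (ball 0 R) := by
    apply DifferentiableOn.diffContOnCl
    rw [closure_ball (0 : ℂ) (by positivity : R ≠ 0)]
    exact hf.mono (closedBall_subset_ball hR1)
  have key := DiscMeanValue.integral_angle hfR hr0 hrR
  -- on the circle `|ζ| = r` the function is constant, equal to `f z`
  have hconst : ∀ θ : ℝ, f (circleMap 0 r θ) = f z := by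
    intro θ
    have hw : ‖circleMap 0 r θ / z‖ = 1 := by
      rw [norm_div, norm_circleMap_zero, abs_of_pos hr0, hr, div_self (norm_ne_zero_iff.mpr hz0)]
    let w : Circle := ⟨circleMap 0 r θ / z, mem_sphere_zero_iff_norm.mpr hw⟩
    have := hinv w z hz
    rw [show ((w : ℂ)) * z = circleMap 0 r θ from div_mul_cancel₀ _ hz0] at this
    exact this
  simp_rw [hconst] at key
  rw [setIntegral_const, measureReal_def, Real.volume_Ioo,
    ENNReal.toReal_ofReal (by linarith [Real.pi_pos]), show π - -π = 2 * π by ring] at key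
  have h2π : (2 * π : ℝ) ≠ 0 := by positivity
  have := congrArg (fun x => (2 * π : ℝ)⁻¹ • x) key
  simpa [smul_smul, inv_mul_cancel₀ h2π] using this

/-! ### The lowest `K`-type has multiplicity one -/

/-- **Weight-`k` vectors are constants**: a holomorphic `f` on the disc with
`π_k(rot u) f = u^{-k} f` on `𝔻` for every `u ∈ Circle` is constant on `𝔻`. -/
theorem eq_const_of_weight (k : ℕ) (f : ℂ → ℂ) (hf : DifferentiableOn ℂ f (ball 0 1))
    (hw : ∀ (u : Circle) (z : ℂ), z ∈ ball (0 : ℂ) 1 →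
      act k (rot u) f z = ((u : ℂ)⁻¹) ^ k * f z) :
    ∀ z ∈ ball (0 : ℂ) 1, f z = f 0 := by
  apply eq_const_of_rot_invariant f hf
  intro w z hz
  obtain ⟨u, rfl⟩ := exists_inv_sq_eq w
  have h := hw u z hz
  rw [act_rot] at h
  have hu : ((u : ℂ)⁻¹) ^ k ≠ 0 := pow_ne_zero _ (inv_ne_zero (Circle.coe_ne_zero u))
  have h' := mul_left_cancel₀ hu h
  rw [← h']
  push_cast
  rfl

/-- The converse: the constants ARE weight-`k` vectors (`act_lowest_apply` with `rot`). -/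
theorem act_rot_const (k : ℕ) (c : ℂ) (u : Circle) (z : ℂ) :
    act k (rot u) (fun _ => c) z = ((u : ℂ)⁻¹) ^ k * c := by
  rw [act_rot]

/-- **Multiplicity one of the lowest `K`-type**: for holomorphic `f` on the disc,
`f` is a weight-`k` vector on `𝔻` iff `f` is constant on `𝔻` (equal to `f 0`). -/
theorem weight_iff_const (k : ℕ) (f : ℂ → ℂ) (hf : DifferentiableOn ℂ f (ball 0 1)) :
    (∀ (u : Circle) (z : ℂ), z ∈ ball (0 : ℂ) 1 →
        act k (rot u) f z = ((u : ℂ)⁻¹) ^ k * f z) ↔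
      ∀ z ∈ ball (0 : ℂ) 1, f z = f 0 := by
  refine ⟨eq_const_of_weight k f hf, fun hc u z hz => ?_⟩
  rw [act_rot, hc z hz, hc _ ?_]
  rw [mem_ball_zero_iff, norm_mul, norm_pow, norm_inv, Circle.norm_coe, inv_one, one_pow, one_mul]
  exact mem_ball_zero_iff.mp hz

end Summit.Ventures.HodgeRepro2.T5BergmanLowestWeight
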